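import Summits.QuantumFields.QCD.Theorems.SeaNonGibbsUniformLoopPotentialMatrix
import Summits.QuantumFields.QCD.Theorems.SeaNonGibbsUniformLoopPotentialDirac
import HarnessLib

/-!
# Quasi-locality of the Wilson fermion determinant under a single-link update

Route `SeaNonGibbs` (QCD), item `UniformLoopPotential` (stmt-QuantumFields-8858): for `m > 0`
(`θ = 4/(m+4) < 1`), a unitary representation `ρ`, a link `e₀ = (x₀, μ₀)` and two gauge fields
`U, U'` that agree on every other link based within `ℓ¹` torus distance `Λ` of `x₀`, the ratio
`|det D_W(U[e₀ ↦ u])| / |det D_W(U'[e₀ ↦ u])|` is, up to the factor `(1 ± δ)^{8N}` with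
`δ = 128 θ^{2(Λ−1)} / ((m+4)²(1−θ)³)`, INDEPENDENT of `u` (`norm_det_update_le_and_ge`).

Mechanism: `D(U[e₀↦u]) = (1 + E(u) K_U) · D(U[e₀↦1])` in determinant, with `E(u)` the update
difference (supported on the `≤ 8N` indices of the endpoints of `e₀`, the same for `U` and `U'`) and
`K_U = P D(U[e₀↦1])⁻¹ P` its compressed resolvent; `‖K_U − K_{U'}‖ ≤ 8 (m+4)⁻² θ^{2(Λ−1)}(1−θ)⁻²`
by the two-sided Neumann tail bound (the fields differ only at distance `≥ Λ`); then
`det(1 + E K_U) = det(1 + E K_{U'}) det(1 + P X P)` with `‖P X P‖ ≤ δ` and the spectral bound with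
the block exponent. No measure theory here (seat ym-line-fcl-p3 g19, free hands).
-/

noncomputable section

open Matrix Finset
open scoped Matrix.Norms.L2Operator
open Literature.Probability.LatticeModels (TorusSite)
open Literature.MathematicalPhysics.QuantumFieldTheory
open Literature.MathematicalPhysics.QuantumLattice

namespace Summit.QuantumFields.QCD.Theorems

namespace UniformLoopPotential

variable {L N : ℕ} [NeZero L] {G : Type*} [Group G] (ρ : G →* Matrix (Fin N) (Fin N) ℂ)

omit [NeZero L] in
/-- `D_W = (m+4) · (1 − A)` with `A = 1 − (m+4)⁻¹ D_W`. -/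
theorem wilsonDirac_eq_smul_one_sub (V : GaugeConfig 4 L G) {m : ℝ} (hm : 0 < m + 4) :
    wilsonDirac ρ V m 1 = ((m + 4 : ℝ) : ℂ) •
      ((1 : Matrix _ _ ℂ) - ((1 : Matrix _ _ ℂ) - ((m + 4 : ℝ) : ℂ)⁻¹ • wilsonDirac ρ V m 1)) := by
  have hc : ((m + 4 : ℝ) : ℂ) ≠ 0 := by exact_mod_cast hm.ne'
  rw [sub_sub_cancel, smul_smul, mul_inv_cancel₀ hc, one_smul]

/-- `‖D_W‖ ≤ (m+4)(1+θ)`. -/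
theorem norm_wilsonDirac_le (hρ : ∀ g, ρ g ∈ Matrix.unitaryGroup (Fin N) ℂ)
    (V : GaugeConfig 4 L G) {m : ℝ} (hm : 0 < m + 4) :
    ‖wilsonDirac ρ V m 1‖ ≤ (m + 4) * (1 + 4 / (m + 4)) := by
  rw [wilsonDirac_eq_smul_one_sub ρ V hm, norm_smul, Complex.norm_real, Real.norm_eq_abs,
    abs_of_pos hm]
  gcongr
  exact (norm_sub_le _ _).trans (add_le_add l2_opNorm_one_le (norm_one_sub_smul_wilsonDirac_le ρ hρ V m hm))

/-- The inverse `D_W⁻¹ = (m+4)⁻¹ (1 − A)⁻¹` and its norm `≤ (m+4)⁻¹ (1−θ)⁻¹` (`m > 0`). -/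
theorem inv_wilsonDirac_eq (hρ : ∀ g, ρ g ∈ Matrix.unitaryGroup (Fin N) ℂ)
    (V : GaugeConfig 4 L G) {m : ℝ} (hm : 0 < m) :
    (wilsonDirac ρ V m 1)⁻¹ = ((m + 4 : ℝ) : ℂ)⁻¹ •
      ((1 : Matrix _ _ ℂ) - ((1 : Matrix _ _ ℂ) - ((m + 4 : ℝ) : ℂ)⁻¹ • wilsonDirac ρ V m 1))⁻¹ ∧
    ‖(wilsonDirac ρ V m 1)⁻¹‖ ≤ (m + 4)⁻¹ * (1 / (1 - 4 / (m + 4))) := by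
  have hm4 : 0 < m + 4 := by linarith
  have hc : ((m + 4 : ℝ) : ℂ) ≠ 0 := by exact_mod_cast hm4.ne'
  set A : Matrix _ _ ℂ := (1 : Matrix _ _ ℂ) - ((m + 4 : ℝ) : ℂ)⁻¹ • wilsonDirac ρ V m 1 with hA
  have hAθ : ‖A‖ ≤ 4 / (m + 4) := norm_one_sub_smul_wilsonDirac_le ρ hρ V m hm4
  have hθ1 : 4 / (m + 4) < 1 := by rw [div_lt_one hm4]; linarith
  have hU : IsUnit ((1 : Matrix _ _ ℂ) - A).det :=
    (Matrix.isUnit_iff_isUnit_det _).1 (isUnit_one_sub_of_norm_lt (hAθ.trans_lt hθ1))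
  have hinv : (wilsonDirac ρ V m 1)⁻¹ = ((m + 4 : ℝ) : ℂ)⁻¹ • ((1 : Matrix _ _ ℂ) - A)⁻¹ := by
    refine Matrix.inv_eq_right_inv ?_
    rw [wilsonDirac_eq_smul_one_sub ρ V hm4, ← hA, Matrix.smul_mul, Matrix.mul_smul,
      Matrix.mul_nonsing_inv _ hU, smul_smul, mul_inv_cancel₀ hc, one_smul]
  refine ⟨hinv, ?_⟩
  rw [hinv, norm_smul, norm_inv, Complex.norm_real, Real.norm_eq_abs, abs_of_pos hm4]
  exact mul_le_mul_of_nonneg_left (norm_inv_one_sub_le hAθ hθ1) (inv_nonneg.2 hm4.le)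

/-- The endpoint block `S = {x₀, x₀ + μ̂₀} × colour × spin` has at most `8N` indices. -/
theorem card_endpointBlock_le (e₀ : Edge 4 L) :
    Fintype.card {p : TorusSite 4 L × Fin N × Fin 4 // p.1 = e₀.1 ∨ p.1 = Site.shift e₀.1 e₀.2} ≤
      8 * N := by
  classical
  let f : {p : TorusSite 4 L × Fin N × Fin 4 // p.1 = e₀.1 ∨ p.1 = Site.shift e₀.1 e₀.2} →
      Bool × (Fin N × Fin 4) := fun p => (decide (p.1.1 = e₀.1), p.1.2)
  have hf : Function.Injective f := by
    rintro ⟨⟨x, c⟩, hx⟩ ⟨⟨y, c'⟩, hy⟩ h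
    simp only at hx hy
    simp only [f, Prod.mk.injEq, decide_eq_decide] at h
    obtain ⟨h1, h2⟩ := h
    have hxy : x = y := by
      rcases hx with hx | hx <;> rcases hy with hy | hy
      · rw [hx, hy]
      · rw [hx, h1.1 hx]
      · rw [hy, h1.2 hy]
      · rw [hx, hy]
    subst hxy; subst h2; rfl
  calc Fintype.card _ ≤ Fintype.card (Bool × (Fin N × Fin 4)) := Fintype.card_le_of_injective f hf
    _ = 8 * N := by simp only [Fintype.card_prod, Fintype.card_bool, Fintype.card_fin]; ring

/-- Indices of the endpoint block are within distance `1` of `x₀`. -/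
theorem siteDist_le_one_of_endpoint {e₀ : Edge 4 L} {p : TorusSite 4 L × Fin N × Fin 4}
    (hp : p.1 = e₀.1 ∨ p.1 = Site.shift e₀.1 e₀.2) :
    (∑ i, (p.1 i - e₀.1 i).valMinAbs.natAbs) ≤ 1 := by
  rcases hp with hp | hp
  · rw [hp, siteDist_self]; exact zero_le_one
  · rw [hp]; exact siteDist_shift_le' e₀.1 e₀.2

/-- **The compressed resolvents of two fields agreeing near `e₀` are exponentially close**:
`‖P D(U[e₀↦1])⁻¹ P − P D(U'[e₀↦1])⁻¹ P‖ ≤ 8 (m+4)⁻² (θ^{Λ−1}/(1−θ))²`. -/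
theorem norm_compressed_inv_sub_le (hρ : ∀ g, ρ g ∈ Matrix.unitaryGroup (Fin N) ℂ) {m : ℝ}
    (hm : 0 < m) {U U' : GaugeConfig 4 L G} {e₀ : Edge 4 L} {Λ : ℕ}
    (hUU' : ∀ e : Edge 4 L, (∑ i, (e.1 i - e₀.1 i).valMinAbs.natAbs) ≤ Λ → e ≠ e₀ → U e = U' e) :
    ‖(Matrix.diagonal fun k : TorusSite 4 L × Fin N × Fin 4 =>
          if (k.1 = e₀.1 ∨ k.1 = Site.shift e₀.1 e₀.2) then (1 : ℂ) else 0) *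
        (wilsonDirac ρ (Function.update U e₀ 1) m 1)⁻¹ *
        (Matrix.diagonal fun k : TorusSite 4 L × Fin N × Fin 4 =>
          if (k.1 = e₀.1 ∨ k.1 = Site.shift e₀.1 e₀.2) then (1 : ℂ) else 0) -
      (Matrix.diagonal fun k : TorusSite 4 L × Fin N × Fin 4 =>
          if (k.1 = e₀.1 ∨ k.1 = Site.shift e₀.1 e₀.2) then (1 : ℂ) else 0) *
        (wilsonDirac ρ (Function.update U' e₀ 1) m 1)⁻¹ *
        (Matrix.diagonal fun k : TorusSite 4 L × Fin N × Fin 4 =>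
          if (k.1 = e₀.1 ∨ k.1 = Site.shift e₀.1 e₀.2) then (1 : ℂ) else 0)‖ ≤
      8 * ((m + 4)⁻¹) ^ 2 * ((4 / (m + 4)) ^ (Λ - 1) * (1 / (1 - 4 / (m + 4)))) ^ 2 := by
  have hm4 : 0 < m + 4 := by linarith
  have hc : ((m + 4 : ℝ) : ℂ) ≠ 0 := by exact_mod_cast hm4.ne'
  have hθ1 : 4 / (m + 4) < 1 := by rw [div_lt_one hm4]; linarith
  set P : Matrix (TorusSite 4 L × Fin N × Fin 4) (TorusSite 4 L × Fin N × Fin 4) ℂ :=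
    Matrix.diagonal fun k => if (k.1 = e₀.1 ∨ k.1 = Site.shift e₀.1 e₀.2) then (1 : ℂ) else 0 with hP
  set D : Matrix _ _ ℂ := wilsonDirac ρ (Function.update U e₀ 1) m 1 with hD
  set D' : Matrix _ _ ℂ := wilsonDirac ρ (Function.update U' e₀ 1) m 1 with hD'
  set A : Matrix _ _ ℂ := (1 : Matrix _ _ ℂ) - ((m + 4 : ℝ) : ℂ)⁻¹ • D with hA
  set A' : Matrix _ _ ℂ := (1 : Matrix _ _ ℂ) - ((m + 4 : ℝ) : ℂ)⁻¹ • D' with hA'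
  obtain ⟨hR, -⟩ := inv_wilsonDirac_eq ρ hρ (Function.update U e₀ 1) hm
  obtain ⟨hR', -⟩ := inv_wilsonDirac_eq ρ hρ (Function.update U' e₀ 1) hm
  rw [← hD, ← hA] at hR
  rw [← hD', ← hA'] at hR'
  have hdet : IsUnit D.det := (wilsonDirac_det_ne_zero_of_pos ρ hρ _ hm).isUnit
  have hdet' : IsUnit D'.det := (wilsonDirac_det_ne_zero_of_pos ρ hρ _ hm).isUnit
  -- `R − R' = R (D' − D) R'`
  have hdiff : D⁻¹ - D'⁻¹ = D⁻¹ * (D' - D) * D'⁻¹ := by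
    rw [Matrix.mul_sub, Matrix.sub_mul, Matrix.mul_assoc, Matrix.mul_nonsing_inv _ hdet',
      Matrix.mul_one, Matrix.nonsing_inv_mul _ hdet, Matrix.one_mul]
  have hkey : P * D⁻¹ * P - P * D'⁻¹ * P =
      ((((m + 4 : ℝ) : ℂ)⁻¹ * ((m + 4 : ℝ) : ℂ)⁻¹) •
        (P * (1 - A)⁻¹ * (D' - D) * (1 - A')⁻¹ * P)) := by
    rw [← Matrix.sub_mul, ← Matrix.mul_sub, hdiff, hR, hR']
    simp only [Matrix.smul_mul, Matrix.mul_smul, smul_smul, Matrix.mul_assoc]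
  rw [hkey, norm_smul, norm_mul, norm_inv, Complex.norm_real, Real.norm_eq_abs, abs_of_pos hm4]
  -- the two-sided tail bound
  have hΔ8 : ‖D' - D‖ ≤ 8 := norm_wilsonDirac_sub_wilsonDirac_le ρ hρ _ _ hm4
  have hfarΔ : (Matrix.diagonal fun k : TorusSite 4 L × Fin N × Fin 4 =>
        if Λ ≤ ∑ i, (k.1 i - e₀.1 i).valMinAbs.natAbs then (1 : ℂ) else 0) * (D' - D) *
      (Matrix.diagonal fun k : TorusSite 4 L × Fin N × Fin 4 =>
        if Λ ≤ ∑ i, (k.1 i - e₀.1 i).valMinAbs.natAbs then (1 : ℂ) else 0) = D' - D := by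
    ext p q
    rw [mul_proj_apply, proj_mul_apply]
    by_cases hpq : Λ ≤ (∑ i, (p.1 i - e₀.1 i).valMinAbs.natAbs) ∧
        Λ ≤ ∑ i, (q.1 i - e₀.1 i).valMinAbs.natAbs
    · rw [if_pos hpq.2, if_pos hpq.1]
    · have h0 : (D' - D) p q = 0 := by
        rw [Matrix.sub_apply, sub_eq_zero, hD', hD]
        exact (wilsonDirac_update_apply_eq_of_agree ρ hUU' 1 m 1 hpq).symm
      rw [h0]; split_ifs <;> rfl
  have hAr : ∀ x y, A x y ≠ 0 → (∑ i, (x.1 i - y.1 i).valMinAbs.natAbs) ≤ 1 := fun x y h =>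
    siteDist_le_one_of_one_sub_smul_ne_zero ρ _ m 1 _ h
  have hA'r : ∀ x y, A' x y ≠ 0 → (∑ i, (x.1 i - y.1 i).valMinAbs.natAbs) ≤ 1 := fun x y h =>
    siteDist_le_one_of_one_sub_smul_ne_zero ρ _ m 1 _ h
  have hfar : ∀ x y : TorusSite 4 L × Fin N × Fin 4, (x.1 = e₀.1 ∨ x.1 = Site.shift e₀.1 e₀.2) →
      Λ ≤ (∑ i, (y.1 i - e₀.1 i).valMinAbs.natAbs) → Λ - 1 ≤ ∑ i, (x.1 i - y.1 i).valMinAbs.natAbs := by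
    intro x y hx hy
    have h1 := siteDist_le_one_of_endpoint (N := N) hx
    have ht := siteDist_triangle y.1 x.1 e₀.1
    rw [siteDist_comm y.1 x.1] at ht
    omega
  have hb := norm_proj_inv_mul_inv_proj_le (fun x y : TorusSite 4 L × Fin N × Fin 4 =>
      ∑ i, (x.1 i - y.1 i).valMinAbs.natAbs) (fun x => siteDist_self x.1)
    (fun x y z => siteDist_triangle x.1 y.1 z.1) (fun x y => siteDist_comm x.1 y.1) hAr hA'r
    (norm_one_sub_smul_wilsonDirac_le ρ hρ _ m hm4) (norm_one_sub_smul_wilsonDirac_le ρ hρ _ m hm4)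
    hθ1 (fun k => k.1 = e₀.1 ∨ k.1 = Site.shift e₀.1 e₀.2)
    (fun k => Λ ≤ ∑ i, (k.1 i - e₀.1 i).valMinAbs.natAbs) hfarΔ hfar
  have hθ0 : 0 ≤ 4 / (m + 4) := div_nonneg (by norm_num) hm4.le
  have h1θ : 0 ≤ 1 / (1 - 4 / (m + 4)) := div_nonneg zero_le_one (by linarith)
  calc (m + 4)⁻¹ * (m + 4)⁻¹ * ‖P * (1 - A)⁻¹ * (D' - D) * (1 - A')⁻¹ * P‖
      ≤ (m + 4)⁻¹ * (m + 4)⁻¹ * ((4 / (m + 4)) ^ (Λ - 1) * (1 / (1 - 4 / (m + 4))) * ‖D' - D‖ *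
          (1 / (1 - 4 / (m + 4))) * (4 / (m + 4)) ^ (Λ - 1)) := by
        gcongr
    _ ≤ (m + 4)⁻¹ * (m + 4)⁻¹ * ((4 / (m + 4)) ^ (Λ - 1) * (1 / (1 - 4 / (m + 4))) * 8 *
          (1 / (1 - 4 / (m + 4))) * (4 / (m + 4)) ^ (Λ - 1)) := by
        gcongr
    _ = 8 * ((m + 4)⁻¹) ^ 2 * ((4 / (m + 4)) ^ (Λ - 1) * (1 / (1 - 4 / (m + 4)))) ^ 2 := by ring

/-- **Quasi-locality of the fermion determinant under a single-link update.** For `m > 0`, two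
fields agreeing near `e₀` (links within distance `Λ`), and every `u`:
`(1−δ)^{8N} · c · |det D(U'[e₀↦u])| ≤ |det D(U[e₀↦u])| ≤ (1+δ)^{8N} · c · |det D(U'[e₀↦u])|` with
`c = |det D(U[e₀↦1])| / |det D(U'[e₀↦1])|` independent of `u` and
`δ = (1 + (1+θ)/(1−θ)) · 8 · 8 (m+4)⁻² (θ^{Λ−1}/(1−θ))²`, `θ = 4/(m+4)`, provided `δ ≤ 1`. -/
theorem norm_det_update_le_and_ge (hρ : ∀ g, ρ g ∈ Matrix.unitaryGroup (Fin N) ℂ) {m : ℝ}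
    (hm : 0 < m) {U U' : GaugeConfig 4 L G} {e₀ : Edge 4 L} {Λ : ℕ}
    (hUU' : ∀ e : Edge 4 L, (∑ i, (e.1 i - e₀.1 i).valMinAbs.natAbs) ≤ Λ → e ≠ e₀ → U e = U' e)
    (hδ1 : (1 + (1 + 4 / (m + 4)) * (1 / (1 - 4 / (m + 4)))) * 8 *
      (8 * ((m + 4)⁻¹) ^ 2 * ((4 / (m + 4)) ^ (Λ - 1) * (1 / (1 - 4 / (m + 4)))) ^ 2) ≤ 1) (u : G) :
    (1 - (1 + (1 + 4 / (m + 4)) * (1 / (1 - 4 / (m + 4)))) * 8 *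
        (8 * ((m + 4)⁻¹) ^ 2 * ((4 / (m + 4)) ^ (Λ - 1) * (1 / (1 - 4 / (m + 4)))) ^ 2)) ^ (8 * N) *
        (‖(wilsonDirac ρ (Function.update U e₀ 1) m 1).det‖ /
            ‖(wilsonDirac ρ (Function.update U' e₀ 1) m 1).det‖ *
          ‖(wilsonDirac ρ (Function.update U' e₀ u) m 1).det‖) ≤
      ‖(wilsonDirac ρ (Function.update U e₀ u) m 1).det‖ ∧
    ‖(wilsonDirac ρ (Function.update U e₀ u) m 1).det‖ ≤
      (1 + (1 + (1 + 4 / (m + 4)) * (1 / (1 - 4 / (m + 4)))) * 8 *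
        (8 * ((m + 4)⁻¹) ^ 2 * ((4 / (m + 4)) ^ (Λ - 1) * (1 / (1 - 4 / (m + 4)))) ^ 2)) ^ (8 * N) *
        (‖(wilsonDirac ρ (Function.update U e₀ 1) m 1).det‖ /
            ‖(wilsonDirac ρ (Function.update U' e₀ 1) m 1).det‖ *
          ‖(wilsonDirac ρ (Function.update U' e₀ u) m 1).det‖) := by
  have hm4 : 0 < m + 4 := by linarith
  have hθ1 : 4 / (m + 4) < 1 := by rw [div_lt_one hm4]; linarith
  have hθ0 : 0 ≤ 4 / (m + 4) := div_nonneg (by norm_num) hm4.le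
  set θ : ℝ := 4 / (m + 4) with hθ
  set δ : ℝ := (1 + (1 + θ) * (1 / (1 - θ))) * 8 *
    (8 * ((m + 4)⁻¹) ^ 2 * (θ ^ (Λ - 1) * (1 / (1 - θ))) ^ 2) with hδ
  set P : Matrix (TorusSite 4 L × Fin N × Fin 4) (TorusSite 4 L × Fin N × Fin 4) ℂ :=
    Matrix.diagonal fun k => if (k.1 = e₀.1 ∨ k.1 = Site.shift e₀.1 e₀.2) then (1 : ℂ) else 0 with hP
  set D₁ : Matrix _ _ ℂ := wilsonDirac ρ (Function.update U e₀ 1) m 1 with hD₁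
  set D₁' : Matrix _ _ ℂ := wilsonDirac ρ (Function.update U' e₀ 1) m 1 with hD₁'
  set Du : Matrix _ _ ℂ := wilsonDirac ρ (Function.update U e₀ u) m 1 with hDu
  set Du' : Matrix _ _ ℂ := wilsonDirac ρ (Function.update U' e₀ u) m 1 with hDu'
  set E : Matrix _ _ ℂ := Du - D₁ with hE
  have hE' : Du' - D₁' = E := (wilsonDirac_update_sub_update_eq ρ U U' e₀ u 1 m 1).symm
  have hEsupp : ∀ i j : TorusSite 4 L × Fin N × Fin 4,
      ¬ ((i.1 = e₀.1 ∨ i.1 = Site.shift e₀.1 e₀.2) ∧ (j.1 = e₀.1 ∨ j.1 = Site.shift e₀.1 e₀.2)) →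
      E i j = 0 := fun i j hij =>
    wilsonDirac_update_sub_update_apply_eq_zero ρ U e₀ u 1 m 1 hij
  have hdet₁ : D₁.det ≠ 0 := wilsonDirac_det_ne_zero_of_pos ρ hρ _ hm
  have hdet₁' : D₁'.det ≠ 0 := wilsonDirac_det_ne_zero_of_pos ρ hρ _ hm
  have hdetu' : Du'.det ≠ 0 := wilsonDirac_det_ne_zero_of_pos ρ hρ _ hm
  -- factorizations `D(u) = (1 + E R) D(1)`
  have hfac : Du = (1 + E * D₁⁻¹) * D₁ := by
    rw [Matrix.add_mul, Matrix.one_mul, Matrix.mul_assoc, Matrix.nonsing_inv_mul _ hdet₁.isUnit,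
      Matrix.mul_one, hE, add_sub_cancel]
  have hfac' : Du' = (1 + E * D₁'⁻¹) * D₁' := by
    rw [Matrix.add_mul, Matrix.one_mul, Matrix.mul_assoc, Matrix.nonsing_inv_mul _ hdet₁'.isUnit,
      Matrix.mul_one, ← hE', add_sub_cancel]
  have hdetfac : Du.det = (1 + E * (P * D₁⁻¹ * P)).det * D₁.det := by
    rw [hfac, Matrix.det_mul, det_one_add_mul_eq_compressed _ hEsupp]
  have hT' : (1 + E * D₁'⁻¹).det ≠ 0 := by
    intro h0
    apply hdetu'
    rw [hfac', Matrix.det_mul, h0, zero_mul]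
  have hdetfac' : Du'.det = (1 + E * (P * D₁'⁻¹ * P)).det * D₁'.det := by
    rw [hfac', Matrix.det_mul, det_one_add_mul_eq_compressed _ hEsupp]
  have hV : IsUnit (1 + E * (P * D₁'⁻¹ * P)).det := by
    rw [← det_one_add_mul_eq_compressed _ hEsupp]
    exact hT'.isUnit
  -- the perturbation step
  have hpert := det_one_add_compressed_eq_mul (fun k : TorusSite 4 L × Fin N × Fin 4 =>
    k.1 = e₀.1 ∨ k.1 = Site.shift e₀.1 e₀.2) E D₁⁻¹ D₁'⁻¹ hV
  simp only [← hP] at hpert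
  set X : Matrix _ _ ℂ := (1 + E * (P * D₁'⁻¹ * P))⁻¹ * E * (P * D₁⁻¹ * P - P * D₁'⁻¹ * P) with hX
  -- the size of `P X P`
  have hinvT' : ‖(1 + E * D₁'⁻¹)⁻¹‖ ≤ (1 + θ) * (1 / (1 - θ)) := by
    have hinv : (1 + E * D₁'⁻¹)⁻¹ = D₁' * Du'⁻¹ := by
      refine Matrix.inv_eq_right_inv ?_
      have : (1 + E * D₁'⁻¹) = Du' * D₁'⁻¹ := by
        rw [hfac', Matrix.mul_assoc, Matrix.mul_nonsing_inv _ hdet₁'.isUnit, Matrix.mul_one]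
      rw [this, Matrix.mul_assoc, ← Matrix.mul_assoc D₁'⁻¹, Matrix.nonsing_inv_mul _ hdet₁'.isUnit,
        Matrix.one_mul, Matrix.mul_nonsing_inv _ hdetu'.isUnit]
    rw [hinv]
    calc ‖D₁' * Du'⁻¹‖ ≤ ‖D₁'‖ * ‖Du'⁻¹‖ := Matrix.l2_opNorm_mul _ _
      _ ≤ ((m + 4) * (1 + θ)) * ((m + 4)⁻¹ * (1 / (1 - θ))) :=
          mul_le_mul (norm_wilsonDirac_le ρ hρ _ hm4) (inv_wilsonDirac_eq ρ hρ _ hm).2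
            (norm_nonneg _) (by positivity)
      _ = (1 + θ) * (1 / (1 - θ)) := by field_simp
  have hXn : ‖P * X * P‖ ≤ δ := by
    have hK := norm_compressed_inv_sub_le ρ hρ hm hUU'
    simp only [← hP, ← hD₁, ← hD₁'] at hK
    calc ‖P * X * P‖ ≤ ‖P * X‖ * ‖P‖ := Matrix.l2_opNorm_mul _ _
      _ ≤ (‖P‖ * ‖X‖) * ‖P‖ := by gcongr; exact Matrix.l2_opNorm_mul _ _
      _ ≤ (1 * ‖X‖) * 1 := by
          gcongr
          · exact norm_proj_le_one _
          · exact norm_proj_le_one _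
      _ = ‖X‖ := by ring
      _ ≤ ‖(1 + E * (P * D₁'⁻¹ * P))⁻¹ * E‖ * ‖P * D₁⁻¹ * P - P * D₁'⁻¹ * P‖ := Matrix.l2_opNorm_mul _ _
      _ ≤ (‖(1 + E * (P * D₁'⁻¹ * P))⁻¹‖ * ‖E‖) * ‖P * D₁⁻¹ * P - P * D₁'⁻¹ * P‖ := by
          gcongr; exact Matrix.l2_opNorm_mul _ _
      _ ≤ ((1 + (1 + θ) * (1 / (1 - θ))) * 8) *
            (8 * ((m + 4)⁻¹) ^ 2 * (θ ^ (Λ - 1) * (1 / (1 - θ))) ^ 2) := by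
          gcongr
          · exact (norm_inv_one_add_compressed_le _ hEsupp D₁'⁻¹ hT'.isUnit).trans (by gcongr)
          · exact norm_wilsonDirac_sub_wilsonDirac_le ρ hρ _ _ hm4
      _ = δ := by rw [hδ]
  -- determinant bounds with the block exponent
  have hδ0 : 0 ≤ δ := (norm_nonneg _).trans hXn
  have hsuppX : ∀ i j : TorusSite 4 L × Fin N × Fin 4,
      ¬ ((i.1 = e₀.1 ∨ i.1 = Site.shift e₀.1 e₀.2) ∧ (j.1 = e₀.1 ∨ j.1 = Site.shift e₀.1 e₀.2)) →
      (P * X * P) i j = 0 := fun i j hij => proj_mul_mul_proj_supported _ X i j hij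
  obtain ⟨hlow, hup⟩ := det_one_add_block_bounds (fun k : TorusSite 4 L × Fin N × Fin 4 =>
    k.1 = e₀.1 ∨ k.1 = Site.shift e₀.1 e₀.2) (P * X * P) hsuppX hδ0 hδ1 hXn (card_endpointBlock_le e₀)
  -- assemble
  have hnorm : ‖Du.det‖ = ‖(1 + P * X * P).det‖ * (‖D₁.det‖ / ‖D₁'.det‖ * ‖Du'.det‖) := by
    have h1 : ‖Du'.det‖ = ‖(1 + E * (P * D₁'⁻¹ * P)).det‖ * ‖D₁'.det‖ := by
      rw [hdetfac', norm_mul]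
    have hpos : 0 < ‖D₁'.det‖ := norm_pos_iff.2 hdet₁'
    rw [hdetfac, hpert, norm_mul, norm_mul, h1]
    field_simp
  rw [hnorm]
  have hrest : 0 ≤ ‖D₁.det‖ / ‖D₁'.det‖ * ‖Du'.det‖ := by positivity
  exact ⟨mul_le_mul_of_nonneg_right hlow hrest, mul_le_mul_of_nonneg_right hup hrest⟩

end UniformLoopPotential

end Summit.QuantumFields.QCD.Theorems

end
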